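import Summits.PneNP.PneNP.Theorems.SzkEntropyPeaThreeNotInPCoreStubFP
import Summits.PneNP.PneNP.Theorems.SzkEntropyPeaThreeNotInPCoreStubPass
import Summits.PneNP.PneNP.Theorems.SzkEntropyPeaThreeNotInPCoreStubLinAlg
import Summits.PneNP.PneNP.Theorems.SzkEntropyPeaThreeNotInPCoreStubFixedPair
import Summits.PneNP.PneNP.Theorems.SzkEntropyPeaThreeNotInPCoreStubCore
import Summits.PneNP.PneNP.Theorems.SzkEntropyPeaThreeNotInPStubGap
import Summits.PneNP.PneNP.Theorems.SzkEntropyPeaThreeNotInPStubEvent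
import Summits.PneNP.PneNP.Theorems.SzkEntropyPeaThreeNotInPStubTransfer

/-!
# Route SzkEntropy, crux `PeaThreeNotInP` (stmt-PneNP-10776), line `SketchIdeator3`, step S7:
# `TensorIsoFull ≤ₚ TensorIso` (registered stub `stub_reduction`)

Assembly of step S7 (full 3-Tensor Isomorphism over `F₂`, no promise, Karp-reduces to the
concise-promise problem `TensorIso` of the line) from the landed stubs: the untyped core map is
`CodeFP` (`stub_coreMapFP`), one Gauss–Jordan pass is correct (`stub_pass`), full-column-rank linear
algebra (`stub_linalg`: frame transport, range factor, left inverses), the fixed concise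
non-isomorphic pair (`stub_fixedPair`), three passes give a concise core and the rank triple
(`stub_core`).  This file adds

* §1 UNIQUENESS OF CONCISE CORES up to isomorphism (`red_iso_iff`): if `S = tmul P Q R X` and
  `T = tmul P' Q' R' Y` with `X, Y` concise of one format and all matrices of full column rank, then
  `Iso S T ↔ Iso X Y` — (⇐) frame transport; (⇒) the column space of each flattening of `S` is that
  of `P` (resp. `Q`, `R`), so two presentations of one tensor differ by invertible right factors
  (range factor), which cancel against left inverses [GrochowQiao2023, §2];
* §2 the typed bridge `rawTI (coreMap I) = coreMapN (rawTI I)`, hence `coreMap` is `FP` on the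
  Boolean codes, and the semantics of the output instance;
* §3 `stub_reduction : TensorIsoFull.PolyTimeReducible TensorIso` and the S7 transfer
  `peaThreeNotInP_of_tensorIsoFull : TensorIsoFull ∉ PromiseP → PeaThreeNotInP`.

Sources: J. A. Grochow, Y. Qiao, SIAM J. Comput. 52 (2023), §2 (nondegenerate tensors);
O. Goldreich, *On promise problems*, 2006, Def. 1.4 (Karp reductions among promise problems).
-/

noncomputable section

open Matrix
open scoped Kronecker
open _root_.Computability
open Literature.Computability.Complexity

namespace Summit.PneNP.PneNP.Cruxes.PeaThreeNotInP.TensorIsoLine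

set_option linter.dupNamespace false -- `Summit.PneNP.PneNP.…`: summit = sub-problem name (D-0017 single-conjunct layout)

variable {a b c r₁ r₂ r₃ : ℕ}

/-! ### §1 Uniqueness of concise cores up to isomorphism -/

/-- `tmul` by three identity matrices is the identity. [folklore] -/
theorem red_tmul_one (X : Tensor3 a b c) :
    tmul (1 : Matrix (Fin a) (Fin a) (ZMod 2)) (1 : Matrix (Fin b) (Fin b) (ZMod 2))
      (1 : Matrix (Fin c) (Fin c) (ZMod 2)) X = X := by
  simp only [tmul, Matrix.one_kronecker_one, Matrix.transpose_one, Matrix.mul_one, Matrix.one_mul]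

/-- The square case of `tmul` is the action `tensorAct`. [GrochowQiao2023, §2] -/
theorem red_tensorAct_eq_tmul (g : Triple a b c) (X : Tensor3 a b c) :
    tensorAct g X = tmul g.1 g.2.1 g.2.2 X := rfl

/-- A right factor of full row rank does not change the column space:
`range (P M) = range P` when the `r × ι` matrix `M` has rank `r`. [folklore] -/
theorem red_range_mul_of_rank_eq {ι : Type} [Fintype ι] [DecidableEq ι] {r : ℕ}
    (P : Matrix (Fin a) (Fin r) (ZMod 2)) {M : Matrix (Fin r) ι (ZMod 2)} (hM : M.rank = r) :
    LinearMap.range (P * M).mulVecLin = LinearMap.range P.mulVecLin := by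
  have htop : LinearMap.range M.mulVecLin = ⊤ := by
    apply Submodule.eq_top_of_finrank_eq
    rw [Module.finrank_fin_fun]
    exact hM
  rw [Matrix.mulVecLin_mul, LinearMap.range_comp, htop, Submodule.map_top]

/-- The column space of a core presentation is that of its first matrix:
`range (tmul P Q R X) = range P` for `X` of full first-flattening rank and `Q, R` left-invertible.
[GrochowQiao2023, §2] -/
theorem red_range_tmul {P : Matrix (Fin a) (Fin r₁) (ZMod 2)} {Q : Matrix (Fin b) (Fin r₂) (ZMod 2)}
    {R : Matrix (Fin c) (Fin r₃) (ZMod 2)} {Q' : Matrix (Fin r₂) (Fin b) (ZMod 2)}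
    {R' : Matrix (Fin r₃) (Fin c) (ZMod 2)} (hQ : Q' * Q = 1) (hR : R' * R = 1)
    {X : Tensor3 r₁ r₂ r₃} (hX : X.rank = r₁) :
    LinearMap.range (tmul P Q R X).mulVecLin = LinearMap.range P.mulVecLin := by
  rw [tmul, Matrix.mul_assoc]
  exact red_range_mul_of_rank_eq P (by rw [core_rank_mul_transpose X (core_kronecker_leftInv hQ hR), hX])

/-- **Two concise core presentations of one tensor are isomorphic**: if
`tmul P Q R X = tmul P' Q' R' Y` with `X, Y` concise and all six matrices of full column rank, then
`Iso X Y` (equal column spaces of the three flattenings ⇒ `P' = P g₁`, `Q' = Q g₂`, `R' = R g₃` with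
invertible `gᵢ`; cancel `P, Q, R` by left inverses). [GrochowQiao2023, §2] -/
theorem red_iso_of_presentations {X Y : Tensor3 r₁ r₂ r₃} (hX : Concise X) (hY : Concise Y)
    {P P' : Matrix (Fin a) (Fin r₁) (ZMod 2)} {Q Q' : Matrix (Fin b) (Fin r₂) (ZMod 2)}
    {R R' : Matrix (Fin c) (Fin r₃) (ZMod 2)} (hP : P.rank = r₁) (hQ : Q.rank = r₂)
    (hR : R.rank = r₃) (hP' : P'.rank = r₁) (hQ' : Q'.rank = r₂) (hR' : R'.rank = r₃)
    (h : tmul P Q R X = tmul P' Q' R' Y) : Iso X Y := by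
  obtain ⟨Pl, hPl⟩ := linalg_leftInverse P hP
  obtain ⟨Ql, hQl⟩ := linalg_leftInverse Q hQ
  obtain ⟨Rl, hRl⟩ := linalg_leftInverse R hR
  obtain ⟨Pl', hPl'⟩ := linalg_leftInverse P' hP'
  obtain ⟨Ql', hQl'⟩ := linalg_leftInverse Q' hQ'
  obtain ⟨Rl', hRl'⟩ := linalg_leftInverse R' hR'
  obtain ⟨hX₁, hX₂, hX₃⟩ := hX
  obtain ⟨hY₁, hY₂, hY₃⟩ := hY
  -- equal column spaces in the three directions
  have h₁ : LinearMap.range P.mulVecLin = LinearMap.range P'.mulVecLin := by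
    rw [← red_range_tmul hQl hRl hX₁, h, red_range_tmul hQl' hRl' hY₁]
  have hrot := congrArg rotT h
  rw [core_rotT_tmul, core_rotT_tmul] at hrot
  have h₂ : LinearMap.range Q.mulVecLin = LinearMap.range Q'.mulVecLin := by
    rw [← red_range_tmul hRl hPl (X := rotT X) (by rw [core_rank_rotT, hX₂]), hrot,
      red_range_tmul hRl' hPl' (by rw [core_rank_rotT, hY₂])]
  have hrot₂ := congrArg rotT hrot
  rw [core_rotT_tmul, core_rotT_tmul] at hrot₂
  have h₃ : LinearMap.range R.mulVecLin = LinearMap.range R'.mulVecLin := by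
    rw [← red_range_tmul hPl hQl (X := rotT (rotT X)) (by rw [core_rotT_rotT, hX₃]), hrot₂,
      red_range_tmul hPl' hQl' (by rw [core_rotT_rotT, hY₃])]
  obtain ⟨g₁, hg₁, hPg⟩ := linalg_rangeFactor P P' hP hP' h₁
  obtain ⟨g₂, hg₂, hQg⟩ := linalg_rangeFactor Q Q' hQ hQ' h₂
  obtain ⟨g₃, hg₃, hRg⟩ := linalg_rangeFactor R R' hR hR' h₃
  refine ⟨(g₁, g₂, g₃), hg₁, hg₂, hg₃, ?_⟩
  rw [red_tensorAct_eq_tmul]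
  have hc : tmul Pl Ql Rl (tmul P Q R X) = tmul Pl Ql Rl (tmul P Q R (tmul g₁ g₂ g₃ Y)) := by
    rw [h, core_tmul_tmul P Q R g₁ g₂ g₃, hPg, hQg, hRg]
  rwa [core_tmul_tmul, core_tmul_tmul, hPl, hQl, hRl, red_tmul_one, red_tmul_one] at hc

/-- **Uniqueness of concise cores up to isomorphism**: tensors with concise cores of one format
are isomorphic iff their cores are. [GrochowQiao2023, §2] -/
theorem red_iso_iff {S T : Tensor3 a b c} {X Y : Tensor3 r₁ r₂ r₃} (hS : IsCoreOf S X)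
    (hT : IsCoreOf T Y) : Iso S T ↔ Iso X Y := by
  obtain ⟨hX, P, Q, R, hP, hQ, hR, hSe⟩ := hS
  obtain ⟨hY, P', Q', R', hP', hQ', hR', hTe⟩ := hT
  constructor
  · rintro ⟨h, hA, hB, hC, hST⟩
    rw [hTe, red_tensorAct_eq_tmul, core_tmul_tmul] at hST
    refine red_iso_of_presentations hX hY hP hQ hR ?_ ?_ ?_ (hSe.symm.trans hST)
    · rw [Matrix.rank_mul_eq_right_of_isUnit_det _ _ ((Matrix.isUnit_iff_isUnit_det _).mp hA), hP']
    · rw [Matrix.rank_mul_eq_right_of_isUnit_det _ _ ((Matrix.isUnit_iff_isUnit_det _).mp hB), hQ']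
    · rw [Matrix.rank_mul_eq_right_of_isUnit_det _ _ ((Matrix.isUnit_iff_isUnit_det _).mp hC), hR']
  · rintro ⟨g, hg₁, hg₂, hg₃, hXY⟩
    rw [hXY, red_tensorAct_eq_tmul, core_tmul_tmul] at hSe
    have r1 : (P * g.1).rank = r₁ := by
      rw [Matrix.rank_mul_eq_left_of_isUnit_det _ _ ((Matrix.isUnit_iff_isUnit_det _).mp hg₁), hP]
    have r2 : (Q * g.2.1).rank = r₂ := by
      rw [Matrix.rank_mul_eq_left_of_isUnit_det _ _ ((Matrix.isUnit_iff_isUnit_det _).mp hg₂), hQ]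
    have r3 : (R * g.2.2).rank = r₃ := by
      rw [Matrix.rank_mul_eq_left_of_isUnit_det _ _ ((Matrix.isUnit_iff_isUnit_det _).mp hg₃), hR]
    obtain ⟨A, hA, hAP⟩ := linalg_frameTransport P' (P * g.1) hP' r1
    obtain ⟨B, hB, hBQ⟩ := linalg_frameTransport Q' (Q * g.2.1) hQ' r2
    obtain ⟨C, hC, hCR⟩ := linalg_frameTransport R' (R * g.2.2) hR' r3
    refine ⟨(A, B, C), hA, hB, hC, ?_⟩
    rw [hTe, red_tensorAct_eq_tmul, core_tmul_tmul, hSe]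
    simp only [hAP, hBQ, hCR]

/-- Isomorphic tensors have the same three flattening ranks. [GrochowQiao2023, §2] -/
theorem red_ranks_eq_of_iso {S T : Tensor3 a b c} (h : Iso S T) :
    (S.rank, (flat₂ S).rank, (flat₃ S).rank) = (T.rank, (flat₂ T).rank, (flat₃ T).rank) := by
  obtain ⟨g, hA, hB, hC, rfl⟩ := h
  rw [flat₂_tensorAct, flat₃_tensorAct, show tensorAct g T = g.1 * T * (g.2.1 ⊗ₖ g.2.2)ᵀ from rfl,
    rank_mul_mul_of_isUnit T hA (isUnit_kronecker_transpose hB hC),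
    rank_mul_mul_of_isUnit (flat₂ T) hB (isUnit_kronecker_transpose hA hC),
    rank_mul_mul_of_isUnit (flat₃ T) hC (isUnit_kronecker_transpose hA hB)]

/-! ### §2 The typed bridge -/

/-- A support tensor is the untyped support tensor of the value triples. [folklore] -/
theorem red_ofSupport_eq (L : List (Fin a × (Fin b × Fin c))) :
    ofSupport L = ofSupportN a b c (L.map valT) := by
  ext i jk
  simp only [ofSupport, ofSupportN, Matrix.of_apply]
  have hv : ((i : ℕ), (jk.1 : ℕ), (jk.2 : ℕ)) = valT (i, jk) := rfl
  by_cases h : (i, jk) ∈ L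
  · rw [if_pos h, if_pos (hv ▸ (List.mem_map_of_injective valT_injective).2 h)]
  · rw [if_neg h, if_neg (fun h' => h ((List.mem_map_of_injective valT_injective).1 (hv ▸ h')))]

/-- Typed-then-untyped conversion of a value-triple list is the in-range filter. [folklore] -/
theorem red_map_valT_filterMap (L : List (ℕ × ℕ × ℕ)) :
    (L.filterMap (finT a b c)).map valT = L.filter (inRangeN (a, b, c)) := by
  induction L with
  | nil => rfl
  | cons p L ih =>
    rw [List.filterMap_cons, List.filter_cons]
    by_cases h : p.1 < a ∧ p.2.1 < b ∧ p.2.2 < c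
    · have hr : inRangeN (a, b, c) p = true := by simp [inRangeN, h]
      rw [show finT a b c p = some (⟨p.1, h.1⟩, ⟨p.2.1, h.2.1⟩, ⟨p.2.2, h.2.2⟩) from dif_pos h, hr,
        if_pos rfl, List.map_cons, ih]
      rfl
    · have hr : inRangeN (a, b, c) p = false := by
        rw [Bool.eq_false_iff]
        intro hq
        apply h
        simpa [inRangeN] using hq
      rw [show finT a b c p = none from dif_neg h, hr, if_neg Bool.false_ne_true, ih]

/-- `rawTI ∘ ofRawTI = clampN`. [folklore] -/
theorem red_rawTI_ofRawTI (y : RawTI) : rawTI (ofRawTI y) = clampN y := by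
  obtain ⟨a', b', c', L, L'⟩ := y
  simp only [rawTI, ofRawTI, clampN, red_map_valT_filterMap]

/-- `clampN` is idempotent. [folklore] -/
theorem red_clampN_clampN (y : RawTI) : clampN (clampN y) = clampN y := by
  obtain ⟨a', b', c', L, L'⟩ := y
  simp only [clampN, List.filter_filter, Bool.and_self]

/-- The untyped Karp map is already clamped. [folklore] -/
theorem red_clampN_coreMapN (x : RawTI) : clampN (coreMapN x) = coreMapN x := by
  unfold coreMapN
  exact red_clampN_clampN _

/-- **The typed Karp map presents as the untyped one**: `rawTI (coreMap I) = coreMapN (rawTI I)`.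
[folklore] -/
theorem red_rawTI_coreMap (I : TIInst) : rawTI (coreMap I) = coreMapN (rawTI I) := by
  rw [coreMap, red_rawTI_ofRawTI, red_clampN_coreMapN]

/-- **The core map is `FP` on the Boolean codes of instances.** [AroraBarak2009, §1.3] -/
theorem red_coreMapFP : CodeFP TIInst.encoding.encode TIInst.encoding.encode coreMap := by
  obtain ⟨f, hf, hspec⟩ := stub_coreMapFP
  refine ⟨f, hf, fun I => ?_⟩
  rw [encode_eq_tiE, hspec, ← red_rawTI_coreMap, encode_eq_tiE]

/-- Out-of-range triples are invisible to `ofSupportN`. [folklore] -/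
theorem red_ofSupportN_filter (L : List (ℕ × ℕ × ℕ)) :
    ofSupportN a b c (L.filter (inRangeN (a, b, c))) = ofSupportN a b c L := by
  ext i jk
  simp only [ofSupportN, Matrix.of_apply, List.mem_filter, inRangeN, Fin.is_lt, decide_true,
    Bool.and_self, and_true]

/-- The first tensor of `ofRawTI y`. [folklore] -/
theorem red_fstT_ofRawTI (y : RawTI) :
    (ofRawTI y).fstT = ofSupportN y.1 y.2.1 y.2.2.1 y.2.2.2.1 := by
  rw [TIInst.fstT, red_ofSupport_eq]
  show ofSupportN y.1 y.2.1 y.2.2.1 ((y.2.2.2.1.filterMap (finT y.1 y.2.1 y.2.2.1)).map valT) = _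
  rw [red_map_valT_filterMap, red_ofSupportN_filter]

/-- The second tensor of `ofRawTI y`. [folklore] -/
theorem red_sndT_ofRawTI (y : RawTI) :
    (ofRawTI y).sndT = ofSupportN y.1 y.2.1 y.2.2.1 y.2.2.2.2 := by
  rw [TIInst.sndT, red_ofSupport_eq]
  show ofSupportN y.1 y.2.1 y.2.2.1 ((y.2.2.2.2.filterMap (finT y.1 y.2.1 y.2.2.1)).map valT) = _
  rw [red_map_valT_filterMap, red_ofSupportN_filter]

/-- Value triples of typed index triples are in range. [folklore] -/
theorem red_inRange_map_valT (L : List (Fin a × (Fin b × Fin c))) :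
    ∀ p ∈ L.map valT, p.1 < a ∧ p.2.1 < b ∧ p.2.2 < c := by
  intro p hp
  obtain ⟨q, -, rfl⟩ := List.mem_map.1 hp
  exact ⟨q.1.isLt, q.2.1.isLt, q.2.2.isLt⟩

/-- The concise core of a typed support list (three passes, `stub_core` with `stub_pass` and left
inverses): a core presentation and the format = rank triple. [GrochowQiao2023, §2] -/
theorem red_core (L : List (Fin a × (Fin b × Fin c))) :
    IsCoreOf (ofSupport L) (ofSupportN (coreN (L.map valT)).1.1 (coreN (L.map valT)).1.2.1
        (coreN (L.map valT)).1.2.2 (coreN (L.map valT)).2) ∧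
      (coreN (L.map valT)).1 =
        ((ofSupport L).rank, (flat₂ (ofSupport L)).rank, (flat₃ (ofSupport L)).rank) := by
  rw [red_ofSupport_eq]
  exact stub_core stub_pass (fun P h => linalg_leftInverse P h) a b c _ (red_inRange_map_valT L)

/-- **Semantics of the core map**: isomorphic pairs go to isomorphic pairs; non-isomorphic pairs go
to CONCISE non-isomorphic pairs (the two cores when their formats agree — uniqueness of cores —,
the fixed pair `(tU, tW)` otherwise). [GrochowQiao2023, §2] -/
theorem red_coreMap_spec (I : TIInst) :
    (Iso I.fstT I.sndT → Iso (coreMap I).fstT (coreMap I).sndT) ∧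
    (¬ Iso I.fstT I.sndT → Concise (coreMap I).fstT ∧ Concise (coreMap I).sndT ∧
      ¬ Iso (coreMap I).fstT (coreMap I).sndT) := by
  obtain ⟨a, b, c, LS, LT⟩ := I
  obtain ⟨hcS, hfS⟩ := red_core LS
  obtain ⟨hcT, hfT⟩ := red_core LT
  change (Iso (ofSupport LS) (ofSupport LT) →
      Iso (coreMap ⟨a, b, c, LS, LT⟩).fstT (coreMap ⟨a, b, c, LS, LT⟩).sndT) ∧
    (¬ Iso (ofSupport LS) (ofSupport LT) → Concise (coreMap ⟨a, b, c, LS, LT⟩).fstT ∧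
      Concise (coreMap ⟨a, b, c, LS, LT⟩).sndT ∧
      ¬ Iso (coreMap ⟨a, b, c, LS, LT⟩).fstT (coreMap ⟨a, b, c, LS, LT⟩).sndT)
  have hraw : rawTI ⟨a, b, c, LS, LT⟩ = (a, b, c, LS.map valT, LT.map valT) := rfl
  -- name the two cores (keeps `whnf` away from the Gauss–Jordan program)
  rcases hx : coreN (LS.map valT) with ⟨⟨r₁, r₂, r₃⟩, LS₃⟩
  rcases hy : coreN (LT.map valT) with ⟨⟨s₁, s₂, s₃⟩, LT₃⟩
  rw [hx] at hcS hfS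
  rw [hy] at hcT hfT
  dsimp only at hcS hfS hcT hfT
  have hmapN : coreMapN (a, b, c, LS.map valT, LT.map valT) =
      clampN (if (r₁, r₂, r₃) = (s₁, s₂, s₃) then (r₁, r₂, r₃, LS₃, LT₃) else fixedNoN) := by
    unfold coreMapN
    dsimp only
    rw [hx, hy]
  by_cases hfmt : (r₁, r₂, r₃) = (s₁, s₂, s₃)
  · -- formats agree: output the two cores
    rw [if_pos hfmt] at hmapN
    simp only [Prod.mk.injEq] at hfmt
    obtain ⟨rfl, rfl, rfl⟩ := hfmt
    have hmap : coreMap ⟨a, b, c, LS, LT⟩ = ofRawTI (clampN (r₁, r₂, r₃, LS₃, LT₃)) := by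
      rw [coreMap, hraw, hmapN]
    rw [hmap, red_fstT_ofRawTI, red_sndT_ofRawTI]
    simp only [clampN, red_ofSupportN_filter]
    have key := red_iso_iff hcS hcT
    exact ⟨fun h => key.1 h, fun h => ⟨hcS.1, hcT.1, fun h' => h (key.2 h')⟩⟩
  · -- formats differ: the pair cannot be isomorphic; output the fixed pair
    rw [if_neg hfmt] at hmapN
    have hmap : coreMap ⟨a, b, c, LS, LT⟩ = ofRawTI (clampN fixedNoN) := by
      rw [coreMap, hraw, hmapN]
    rw [hmap, red_fstT_ofRawTI, red_sndT_ofRawTI]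
    simp only [clampN, fixedNoN, red_ofSupportN_filter]
    refine ⟨fun h => absurd (hfS.trans ((red_ranks_eq_of_iso h).trans hfT.symm)) hfmt, fun _ => ?_⟩
    exact stub_fixedPair

/-! ### §3 The reduction and the S7 transfer -/

/-- **stub (lead; lands last)**: `TensorIsoFull ≤ₚ TensorIso` by the core map — assembly of
W1–W5 with the uniqueness of concise cores up to isomorphism (equal column spaces ⇒ invertible
right factors, cancellation by left inverses, frame transport) and the typed bridge
`rawTI (coreMap I) = coreMapN (rawTI I)`. [GrochowQiao2023, §2] -/
theorem stub_reduction : TensorIsoFull.PolyTimeReducible TensorIso := by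
  obtain ⟨f, hf, hspec⟩ := red_coreMapFP
  refine ⟨f, hf, ?_, ?_⟩
  · rintro w ⟨I, hI, rfl⟩
    show f (TIInst.encoding.encode I) ∈ TensorIso.yes
    rw [hspec]
    exact ⟨coreMap I, (red_coreMap_spec I).1 hI, rfl⟩
  · rintro w ⟨I, hI, rfl⟩
    show f (TIInst.encoding.encode I) ∈ TensorIso.no
    rw [hspec]
    exact ⟨coreMap I, (red_coreMap_spec I).2 hI, rfl⟩

/-- **S7 transfer: hardness of FULL 3-Tensor Isomorphism over `F₂` (`TI_{F₂} ∉ P`, no promise)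
gives thesis X** (`PEA 3 ∉ PromiseP`), through `TensorIsoFull ≤ₚ TensorIso ≤ … ≤ PEA 3` and the
landed transfer `peaThreeNotInP_of_tensorIso`.  The hypothesis is an OPEN conjecture (GI ≤ TI;
TI ∈ NP, so it implies `P ≠ NP`), not claimed here. [card tensor-iso-monoid-import, S7] -/
theorem peaThreeNotInP_of_tensorIsoFull (h : TensorIsoFull ∉ PromiseP) :
    Summit.PneNP.PneNP.Theses.SzkEntropy.PeaThreeNotInP :=
  peaThreeNotInP_of_tensorIso fun hTI =>
    h (PromiseProblem.mem_PromiseP_of_polyTimeReducible_holds stub_reduction hTI)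

/-- **C⁺ alone gives the summit through this route**: `TI_{F₂} ∉ P → P ≠ NP`, composing the S7
transfer with the route's certified deciding theorem `closes` and its three PROVED supports
(`PeaMemPH_holds`, `PhCollapse_holds`, `CookModelBridge_holds`).  Conditional on the open conjecture
C⁺ only; recorded so that the planner can file C⁺ as a conditional bridge. [card tensor-iso-monoid-import, S7] -/
theorem pneNP_of_tensorIsoFull (h : TensorIsoFull ∉ PromiseP) : _root_.PneNP :=
  Summit.PneNP.PneNP.Theses.SzkEntropy.closes (peaThreeNotInP_of_tensorIsoFull h)
    Summit.PneNP.PneNP.Theses.SzkEntropy.PeaMemPH_holds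
    Summit.PneNP.PneNP.Theses.SzkEntropy.PhCollapse_holds
    Summit.PneNP.PneNP.Theses.SzkEntropy.CookModelBridge_holds

end Summit.PneNP.PneNP.Cruxes.PeaThreeNotInP.TensorIsoLine

end
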